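import Summits.QuantumFields.BalabanUV.Beta.GAN24.DirichletBoxCompression

/-!
# `BalabanUV.T4Continuum.Support.SubtypeDecoupling` — NE2 (node U1a) formalisation swarm, SUPPLIER item «Δ1-DECOUPLE» under the
# owner's sub-row `T4-U1a.S-NE2-D1-DIRICHLET°`, module (1): RESTRICTION MATRICES BETWEEN NESTED SUBTYPES OF ONE AMBIENT INDEX TYPE,
# BLOCK-DIAGONAL («decoupled») ASSEMBLIES OF COMPRESSIONS — compression of a compression, partition of unity, product, INVERSE,
# difference — AND THE NORM LAW `‖E₁ᴴY₁E₁ + E₂ᴴY₂E₂‖ ≤ max ‖Y_i‖` (unit b2b-balaban-t4-ne2-formalise-leaf-08, gen 4, v1)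

HONEST FRAMING.  Rung (B)+1 bookkeeping; this file is GENERIC finite-dimensional linear algebra ([folklore]) extending gen 11's
`Support/SubtypeCompression` (selection matrices, `Matrix.toBlock` in operator norm, block-multiplicativity under vanishing couplings,
coercive compressions — imported BY NAME, nothing restated); it is the algebra behind the EXACT LATTICE DECOUPLING of [B9] (3.24)'s
Ω-restricted operators `Ω₀Δ′_aΩ₀` over block sets whose pieces are not lattice-coupled (module (2) `Support/DirichletDecoupledRegions`).
NE2 (U1a) is NOT proved by this file; spine PROVED 0/9 unchanged; NOT infinite volume, NOT the mass gap, NOT Clay.  HONEST DEPENDENCY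
(verbatim): «continuum YM on T⁴ ⇐ BetaPertH ∧ nine spine estimates (0/9 proved); BetaPertH ⇐ (D1) ∧ (D4) ∧ CAP+tail; G-an2-4 gates
asym, D1 and NE2/3/4.»

WHAT THIS FILE PROVES (0 sorry), for decidable subsets `q, q₁, q₂ ⊆ p` of ONE ambient finite index type `m` (and `q′… ⊆ p′` of `n`,
`q″… ⊆ p″` of `k`):
 * §1 the RESTRICTION matrices **`rsel p q := (1 : Matrix m m ℂ).toBlock q p : ℓ²({p}) → ℓ²({q})`** («restrict the zero-extension»,
   `rsel_mulVec`; adjoint = the opposite restriction, `rsel_conjTranspose`); **`rsel_mul_toBlock_mul`** (COMPRESSION OF A COMPRESSION: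
   `rsel p q · X_{pp′} · (rsel p′ q′)ᴴ = X_{qq′}`), `rsel_mul_rsel_conjTranspose` (`= 1`, `q ⊆ p`), `…_of_disjoint` (`= 0`),
   **`partition_rsel`** (`E₁ᴴE₁ + E₂ᴴE₂ = 1` on `ℓ²({p})` for `p ⊆ q₁ ⊔ q₂`);
 * §2 DECOUPLED ASSEMBLIES: **`toBlock_eq_blockDiag`** — if `X : Matrix m n ℂ` has NO entry between `q₁` and `q₂′` nor between `q₂` and
   `q₁′`, then on `p = q₁ ⊔ q₂`, `p′ = q₁′ ⊔ q₂′`: `X_{pp′} = E₁ᴴ·X_{q₁q₁′}·F₁ + E₂ᴴ·X_{q₂q₂′}·F₂` (`E_i = rsel p q_i`, `F_i = rsel p′ q_i′`);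
   **`blockDiag_mul_blockDiag`** (products, common middle partition), **`inv_blockDiag`** (`(E₁ᴴA₁E₁ + E₂ᴴA₂E₂)⁻¹ = E₁ᴴA₁⁻¹E₁ + E₂ᴴA₂⁻¹E₂`
   for invertible blocks — `Matrix.inv_eq_right_inv`), `blockDiag_sub_blockDiag`;
 * §3 THE NORM LAW **`opNorm_blockDiag_le`**: for DISJOINT `q₁′, q₂′` and DISJOINT `q₁, q₂`, `‖F₁ᴴY₁E₁ + F₂ᴴY₂E₂‖ ≤ c` whenever
   `‖Y₁‖, ‖Y₂‖ ≤ c` (pointwise disjoint supports of the two zero-extensions + `nsq(E₁v) + nsq(E₂v) ≤ nsq v`; via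
   `ScalarAveragedPropagator.opNorm_le_of_nsq_le_rect`, `BalabanBlockPoincare.nsq_mulVec_le_rect`).
Everything is stated on `Matrix.toBlock` restrictions of ONE ambient type — no `Matrix.reindex`/`fromBlocks` (the tree's alternatives:
`Beta/ResolventBlockCertificate.l2_opNorm_fromBlocks_le`, `Literature/Computability/QuantumComplexity/PlaceGateNorm.l2_opNorm_reindex`;
not imported: identifying the reindexed compression with `fromBlocks` costs the same entry bookkeeping as §2).

ABSOLUTE RULE (cell, verbatim): «No internally-minted statement may enter as a cited fact. Every hypothesis is either kernel-proved in
this package or a verbatim quotation of a PUBLISHED theorem with page reference. The manuscript(s) under audit are NOT citable for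
their own disputed steps — they are the thing under adjudication; programme-internal (2001/route/tribunal) claims are never citable.»
[folklore] linear algebra; nothing printed is a hypothesis; no `def … : Prop` fact (`rsel` is data).  NOT CLAIMED: anything about
Bałaban's regions or operators (module (2)); NE2; NE3; «not in print; our proof».
-/

noncomputable section

open scoped BigOperators ComplexConjugate Matrix Matrix.Norms.L2Operator
open Finset

namespace Summit.QuantumFields.BalabanUV.T4Continuum.SubtypeDecoupling

open Literature.MathematicalPhysics.QuantumFieldTheory.Balaban1983to89.B5Prop11Lower (nsq nsq_nonneg)
open Summit.QuantumFields.BalabanUV.T4Continuum.SubtypeCompression (ext ext_apply_of ext_apply_of_not nsq_ext toBlock_one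
  toBlock_conjTranspose toBlock_mul_of_vanish_left toBlock_mul_of_vanish_right)
open Summit.QuantumFields.BalabanUV.T4Continuum.ScalarAveragedPropagator (opNorm_le_of_nsq_le_rect)
open Summit.QuantumFields.BalabanUV.T4Continuum.BalabanBlockPoincare (nsq_mulVec_le_rect)
open Summit.QuantumFields.BalabanUV.Beta.GAN24.DirichletBoxCompression (toBlock_mulVec')

variable {m n k : Type*} [Fintype m] [DecidableEq m] [Fintype n] [DecidableEq n] [Fintype k] [DecidableEq k]

/-! ## §1 Restriction matrices between nested subtypes of ONE ambient index type -/

/-- the RESTRICTION matrix from the sites of `p` to the sites of `q` (two decidable subsets of ONE ambient index type):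
`rsel p q = (1)_{qp}`, `(rsel p q · w)(a) = (ext w)(a)`. [folklore] -/
def rsel (p q : m → Prop) [DecidablePred p] [DecidablePred q] : Matrix {a // q a} {a // p a} ℂ := (1 : Matrix m m ℂ).toBlock q p

section Rsel

variable (p q q₁ q₂ : m → Prop) [DecidablePred p] [DecidablePred q] [DecidablePred q₁] [DecidablePred q₂]
variable (p' q' q₁' q₂' : n → Prop) [DecidablePred p'] [DecidablePred q'] [DecidablePred q₁'] [DecidablePred q₂']
variable (p'' q₁'' q₂'' : k → Prop) [DecidablePred p''] [DecidablePred q₁''] [DecidablePred q₂'']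

omit [Fintype m] in
/-- entries of `rsel`. [folklore] -/
theorem rsel_apply (a : {a // q a}) (b : {b // p b}) : rsel p q a b = if (a : m) = b then 1 else 0 := by
  simp only [rsel, Matrix.toBlock_apply, Matrix.one_apply]

omit [Fintype m] in
/-- `(rsel p q)ᴴ = rsel q p` (the adjoint of a restriction is the opposite restriction = extension by zero). [folklore] -/
theorem rsel_conjTranspose : (rsel p q)ᴴ = rsel q p := by
  rw [rsel, toBlock_conjTranspose, Matrix.conjTranspose_one]; rfl

/-- **COMPRESSION OF A COMPRESSION**: `rsel p q · X_{pp′} · (rsel p′ q′)ᴴ = X_{qq′}` for `q ⊆ p`, `q′ ⊆ p′`. [folklore] -/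
theorem rsel_mul_toBlock_mul (X : Matrix m n ℂ) (hq : ∀ a, q a → p a) (hq' : ∀ b, q' b → p' b) :
    rsel p q * X.toBlock p p' * (rsel p' q')ᴴ = X.toBlock q q' := by
  have h1 : ∀ i j, q i → ¬ p j → (1 : Matrix m m ℂ) i j = 0 := fun i j hi hj => Matrix.one_apply_ne (fun e => hj (e ▸ hq i hi))
  have h2 : ∀ j l, ¬ p' j → q' l → (1 : Matrix n n ℂ) j l = 0 := fun j l hj hl => Matrix.one_apply_ne (fun e => hj (e ▸ hq' l hl))
  rw [rsel_conjTranspose, rsel, rsel, ← toBlock_mul_of_vanish_left q p p' (1 : Matrix m m ℂ) X h1, Matrix.one_mul,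
    ← toBlock_mul_of_vanish_right q p' q' X (1 : Matrix n n ℂ) h2, Matrix.mul_one]

/-- `rsel p q · (rsel p q)ᴴ = 1` for `q ⊆ p` (restricting an extension is the identity). [folklore] -/
theorem rsel_mul_rsel_conjTranspose (hq : ∀ a, q a → p a) : rsel p q * (rsel p q)ᴴ = 1 := by
  have h := rsel_mul_toBlock_mul p q p q (1 : Matrix m m ℂ) hq hq
  rwa [toBlock_one, Matrix.mul_one, toBlock_one] at h

/-- `rsel p q₁ · (rsel p q₂)ᴴ = 0` for DISJOINT `q₁, q₂ ⊆ p`. [folklore] -/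
theorem rsel_mul_rsel_conjTranspose_of_disjoint (hq₁ : ∀ a, q₁ a → p a) (hq₂ : ∀ a, q₂ a → p a) (hd : ∀ a, q₁ a → ¬ q₂ a) :
    rsel p q₁ * (rsel p q₂)ᴴ = 0 := by
  have h := rsel_mul_toBlock_mul p q₁ p q₂ (1 : Matrix m m ℂ) hq₁ hq₂
  rw [toBlock_one, Matrix.mul_one] at h
  rw [h]
  ext a b
  rw [Matrix.toBlock_apply, Matrix.zero_apply]
  exact Matrix.one_apply_ne (fun e => hd a a.2 (e ▸ b.2))

/-- a sum over a subtype of a function supported at ONE ambient point. [folklore] -/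
theorem sum_subtype_ite_eq (a : m) (g : {x // q x} → ℂ) :
    ∑ c : {x // q x}, (if (c : m) = a then g c else 0) = if h : q a then g ⟨a, h⟩ else 0 := by
  by_cases h : q a
  · rw [dif_pos h, Finset.sum_eq_single ⟨a, h⟩]
    · rw [if_pos rfl]
    · intro c _ hc
      exact if_neg fun e => hc (Subtype.ext e)
    · intro habs; exact absurd (Finset.mem_univ _) habs
  · rw [dif_neg h]
    exact Finset.sum_eq_zero fun c _ => if_neg fun e : (c : m) = a => h (e ▸ c.2)

/-- entries of `(rsel p q)ᴴ · rsel p q`: the indicator of `q` on the diagonal. [folklore] -/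
theorem conjTranspose_rsel_mul_rsel_apply (a a' : {a // p a}) :
    ((rsel p q)ᴴ * rsel p q) a a' = if q a ∧ a = a' then 1 else 0 := by
  rw [Matrix.mul_apply]
  have e : ∀ c : {x // q x}, (rsel p q)ᴴ a c * rsel p q c a' = if (c : m) = a then (if (a : m) = a' then (1 : ℂ) else 0) else 0 := by
    intro c
    rw [Matrix.conjTranspose_apply, rsel_apply, rsel_apply]
    by_cases hc : (c : m) = a
    · rw [if_pos hc, if_pos hc, star_one, one_mul, hc]
    · rw [if_neg hc, if_neg hc, star_zero, zero_mul]
  simp_rw [e]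
  rw [sum_subtype_ite_eq q (a : m) (fun _ => if (a : m) = a' then (1 : ℂ) else 0)]
  by_cases h : q a
  · rw [dif_pos h]
    by_cases h' : a = a'
    · rw [if_pos (congrArg Subtype.val h'), if_pos ⟨h, h'⟩]
    · rw [if_neg (fun e => h' (Subtype.ext e)), if_neg (fun hh => h' hh.2)]
  · rw [dif_neg h, if_neg (fun hh => h hh.1)]

/-- **PARTITION OF UNITY**: `(rsel p q₁)ᴴ·rsel p q₁ + (rsel p q₂)ᴴ·rsel p q₂ = 1` on `ℓ²({p})` when `p ⊆ q₁ ∪ q₂` and `q₁ ∩ q₂ = ∅`.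
[folklore] -/
theorem partition_rsel (hp : ∀ a, p a → q₁ a ∨ q₂ a) (hd : ∀ a, q₁ a → ¬ q₂ a) :
    (rsel p q₁)ᴴ * rsel p q₁ + (rsel p q₂)ᴴ * rsel p q₂ = 1 := by
  ext a a'
  rw [Matrix.add_apply, conjTranspose_rsel_mul_rsel_apply, conjTranspose_rsel_mul_rsel_apply, Matrix.one_apply]
  by_cases h' : a = a'
  · rcases hp a a.2 with h1 | h2
    · rw [if_pos ⟨h1, h'⟩, if_neg (fun hh => hd a h1 hh.1), if_pos h', add_zero]
    · rw [if_neg (fun hh => hd a hh.1 h2), if_pos ⟨h2, h'⟩, if_pos h', zero_add]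
  · rw [if_neg (fun hh => h' hh.2), if_neg (fun hh => h' hh.2), if_neg h', add_zero]

/-! ## §2 Decoupled (block-diagonal) assemblies: compression, product, inverse, difference -/

/-- **THE DECOUPLED ASSEMBLY**: if `X` has no entry between `q₁` and `q₂′` nor between `q₂` and `q₁′`, then on `p = q₁ ⊔ q₂`,
`p′ = q₁′ ⊔ q₂′` its compression is the block-diagonal assembly of its two diagonal compressions:
`X_{pp′} = (rsel p q₁)ᴴ·X_{q₁q₁′}·rsel p′ q₁′ + (rsel p q₂)ᴴ·X_{q₂q₂′}·rsel p′ q₂′`. [folklore] -/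
theorem toBlock_eq_blockDiag (X : Matrix m n ℂ) (hp : ∀ a, p a ↔ q₁ a ∨ q₂ a) (hd : ∀ a, q₁ a → ¬ q₂ a)
    (hp' : ∀ b, p' b ↔ q₁' b ∨ q₂' b) (hd' : ∀ b, q₁' b → ¬ q₂' b)
    (hX₁₂ : ∀ a b, q₁ a → q₂' b → X a b = 0) (hX₂₁ : ∀ a b, q₂ a → q₁' b → X a b = 0) :
    X.toBlock p p' = (rsel p q₁)ᴴ * X.toBlock q₁ q₁' * rsel p' q₁' + (rsel p q₂)ᴴ * X.toBlock q₂ q₂' * rsel p' q₂' := by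
  have hq₁ : ∀ a, q₁ a → p a := fun a h => (hp a).mpr (Or.inl h)
  have hq₂ : ∀ a, q₂ a → p a := fun a h => (hp a).mpr (Or.inr h)
  have hq₁' : ∀ b, q₁' b → p' b := fun b h => (hp' b).mpr (Or.inl h)
  have hq₂' : ∀ b, q₂' b → p' b := fun b h => (hp' b).mpr (Or.inr h)
  -- `X_{pp′} = (Σ_i E_iᴴE_i)·X_{pp′}·(Σ_j F_jᴴF_j)` and `E_i X_{pp′} F_jᴴ = X_{q_i q_j′}`, the cross blocks vanishing
  have hE := partition_rsel p q₁ q₂ (fun a h => (hp a).mp h) hd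
  have hF := partition_rsel p' q₁' q₂' (fun b h => (hp' b).mp h) hd'
  have c11 := rsel_mul_toBlock_mul p q₁ p' q₁' X hq₁ hq₁'
  have c22 := rsel_mul_toBlock_mul p q₂ p' q₂' X hq₂ hq₂'
  have c12 : rsel p q₁ * X.toBlock p p' * (rsel p' q₂')ᴴ = 0 := by
    rw [rsel_mul_toBlock_mul p q₁ p' q₂' X hq₁ hq₂']
    ext a b; exact hX₁₂ a b a.2 b.2
  have c21 : rsel p q₂ * X.toBlock p p' * (rsel p' q₁')ᴴ = 0 := by
    rw [rsel_mul_toBlock_mul p q₂ p' q₁' X hq₂ hq₁']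
    ext a b; exact hX₂₁ a b a.2 b.2
  calc X.toBlock p p' = ((rsel p q₁)ᴴ * rsel p q₁ + (rsel p q₂)ᴴ * rsel p q₂) * X.toBlock p p'
        * ((rsel p' q₁')ᴴ * rsel p' q₁' + (rsel p' q₂')ᴴ * rsel p' q₂') := by rw [hE, hF, Matrix.one_mul, Matrix.mul_one]
    _ = (rsel p q₁)ᴴ * (rsel p q₁ * X.toBlock p p' * (rsel p' q₁')ᴴ) * rsel p' q₁'
        + (rsel p q₁)ᴴ * (rsel p q₁ * X.toBlock p p' * (rsel p' q₂')ᴴ) * rsel p' q₂'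
        + (rsel p q₂)ᴴ * (rsel p q₂ * X.toBlock p p' * (rsel p' q₁')ᴴ) * rsel p' q₁'
        + (rsel p q₂)ᴴ * (rsel p q₂ * X.toBlock p p' * (rsel p' q₂')ᴴ) * rsel p' q₂' := by
          rw [rsel_conjTranspose p' q₁', rsel_conjTranspose p' q₂']
          simp only [Matrix.add_mul, Matrix.mul_add, Matrix.mul_assoc]
          abel
    _ = _ := by rw [c11, c12, c21, c22, Matrix.mul_zero, Matrix.zero_mul, Matrix.mul_zero, Matrix.zero_mul, add_zero, add_zero]

/-- absorbing a restriction pair in the middle of a product: `F₁·(F₁ᴴ·W) = W`, `F₁·(F₂ᴴ·W) = 0`. [folklore] -/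
theorem rsel_mul_conjTranspose_rsel_mul {l : Type*} (hq₁' : ∀ b, q₁' b → p' b) (W : Matrix {b // q₁' b} l ℂ) :
    rsel p' q₁' * ((rsel p' q₁')ᴴ * W) = W := by
  rw [← Matrix.mul_assoc, rsel_mul_rsel_conjTranspose p' q₁' hq₁', Matrix.one_mul]

/-- `F₁·(F₂ᴴ·W) = 0` for disjoint `q₁′, q₂′ ⊆ p′`. [folklore] -/
theorem rsel_mul_conjTranspose_rsel_mul_of_disjoint {l : Type*} (hq₁' : ∀ b, q₁' b → p' b) (hq₂' : ∀ b, q₂' b → p' b)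
    (hd' : ∀ b, q₁' b → ¬ q₂' b) (W : Matrix {b // q₂' b} l ℂ) : rsel p' q₁' * ((rsel p' q₂')ᴴ * W) = 0 := by
  rw [← Matrix.mul_assoc, rsel_mul_rsel_conjTranspose_of_disjoint p' q₁' q₂' hq₁' hq₂' hd', Matrix.zero_mul]

/-- **PRODUCT OF DECOUPLED ASSEMBLIES** (common middle partition `p′ ⊇ q₁′ ⊔ q₂′`):
`(E₁ᴴA₁F₁ + E₂ᴴA₂F₂)·(F₁ᴴB₁G₁ + F₂ᴴB₂G₂) = E₁ᴴ(A₁B₁)G₁ + E₂ᴴ(A₂B₂)G₂`. [folklore] -/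
theorem blockDiag_mul_blockDiag (hq₁' : ∀ b, q₁' b → p' b) (hq₂' : ∀ b, q₂' b → p' b) (hd' : ∀ b, q₁' b → ¬ q₂' b)
    (A₁ : Matrix {a // q₁ a} {b // q₁' b} ℂ) (A₂ : Matrix {a // q₂ a} {b // q₂' b} ℂ)
    (B₁ : Matrix {b // q₁' b} {c // q₁'' c} ℂ) (B₂ : Matrix {b // q₂' b} {c // q₂'' c} ℂ) :
    ((rsel p q₁)ᴴ * A₁ * rsel p' q₁' + (rsel p q₂)ᴴ * A₂ * rsel p' q₂')
        * ((rsel p' q₁')ᴴ * B₁ * rsel p'' q₁'' + (rsel p' q₂')ᴴ * B₂ * rsel p'' q₂'')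
      = (rsel p q₁)ᴴ * (A₁ * B₁) * rsel p'' q₁'' + (rsel p q₂)ᴴ * (A₂ * B₂) * rsel p'' q₂'' := by
  have hd'' : ∀ b, q₂' b → ¬ q₁' b := fun b h2 h1 => hd' b h1 h2
  simp only [Matrix.add_mul, Matrix.mul_add, Matrix.mul_assoc]
  rw [rsel_mul_conjTranspose_rsel_mul p' q₁' hq₁', rsel_mul_conjTranspose_rsel_mul p' q₂' hq₂',
    rsel_mul_conjTranspose_rsel_mul_of_disjoint p' q₁' q₂' hq₁' hq₂' hd',
    rsel_mul_conjTranspose_rsel_mul_of_disjoint p' q₂' q₁' hq₂' hq₁' hd'']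
  simp only [Matrix.mul_zero, add_zero, zero_add]

/-- **INVERSE OF A DECOUPLED ASSEMBLY**: on `p = q₁ ⊔ q₂`, `(E₁ᴴA₁E₁ + E₂ᴴA₂E₂)⁻¹ = E₁ᴴA₁⁻¹E₁ + E₂ᴴA₂⁻¹E₂` for invertible
`A₁, A₂`. [folklore] -/
theorem inv_blockDiag (hp : ∀ a, p a ↔ q₁ a ∨ q₂ a) (hd : ∀ a, q₁ a → ¬ q₂ a)
    (A₁ : Matrix {a // q₁ a} {a // q₁ a} ℂ) (A₂ : Matrix {a // q₂ a} {a // q₂ a} ℂ) (hA₁ : IsUnit A₁.det) (hA₂ : IsUnit A₂.det) :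
    ((rsel p q₁)ᴴ * A₁ * rsel p q₁ + (rsel p q₂)ᴴ * A₂ * rsel p q₂)⁻¹
      = (rsel p q₁)ᴴ * A₁⁻¹ * rsel p q₁ + (rsel p q₂)ᴴ * A₂⁻¹ * rsel p q₂ := by
  have hq₁ : ∀ a, q₁ a → p a := fun a h => (hp a).mpr (Or.inl h)
  have hq₂ : ∀ a, q₂ a → p a := fun a h => (hp a).mpr (Or.inr h)
  refine Matrix.inv_eq_right_inv ?_
  rw [blockDiag_mul_blockDiag p q₁ q₂ p q₁ q₂ p q₁ q₂ hq₁ hq₂ hd, Matrix.mul_nonsing_inv _ hA₁, Matrix.mul_nonsing_inv _ hA₂,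
    Matrix.mul_one, Matrix.mul_one]
  exact partition_rsel p q₁ q₂ (fun a h => (hp a).mp h) hd

omit [DecidableEq m] [DecidableEq k] [DecidablePred p] [DecidablePred p''] in
/-- difference of decoupled assemblies. [folklore] -/
theorem blockDiag_sub_blockDiag (E₁ : Matrix {a // p a} {a // q₁ a} ℂ) (E₂ : Matrix {a // p a} {a // q₂ a} ℂ)
    (G₁ : Matrix {c // q₁'' c} {c // p'' c} ℂ) (G₂ : Matrix {c // q₂'' c} {c // p'' c} ℂ)
    (A₁ B₁ : Matrix {a // q₁ a} {c // q₁'' c} ℂ) (A₂ B₂ : Matrix {a // q₂ a} {c // q₂'' c} ℂ) :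
    (E₁ * A₁ * G₁ + E₂ * A₂ * G₂) - (E₁ * B₁ * G₁ + E₂ * B₂ * G₂) = E₁ * (A₁ - B₁) * G₁ + E₂ * (A₂ - B₂) * G₂ := by
  rw [Matrix.mul_sub, Matrix.sub_mul, Matrix.mul_sub, Matrix.sub_mul]
  abel

/-! ## §3 The norm law: a decoupled assembly is bounded by the larger block -/

omit [DecidableEq m] in
/-- a sum over a subtype as an indicator sum over the ambient type. [folklore] -/
theorem sum_subtype_eq_sum_ite (F : m → ℝ) : ∑ b : {x // q x}, F b = ∑ b, (if q b then F b else 0) := by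
  rw [← Fintype.sum_subtype_add_sum_subtype q (fun b => if q b then F b else 0)]
  have h1 : ∑ b : {x // q x}, (if q (b : m) then F b else 0) = ∑ b : {x // q x}, F b :=
    Finset.sum_congr rfl fun b _ => if_pos b.2
  have h2 : ∑ b : {x // ¬ q x}, (if q (b : m) then F b else 0) = 0 := Finset.sum_eq_zero fun b _ => if_neg b.2
  rw [h1, h2, add_zero]

omit [DecidableEq m] in
/-- a sum of a nonnegative function over a subtype is at most the full sum. [folklore] -/
theorem sum_subtype_le_sum {F : m → ℝ} (hF : ∀ b, 0 ≤ F b) : ∑ b : {x // q x}, F b ≤ ∑ b, F b := by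
  rw [sum_subtype_eq_sum_ite q F]
  exact Finset.sum_le_sum fun b _ => by split_ifs <;> simp [hF b]

omit [DecidableEq m] in
/-- sums of a nonnegative function over two DISJOINT subtypes add up to at most the full sum. [folklore] -/
theorem sum_subtype_add_sum_subtype_le {F : m → ℝ} (hF : ∀ b, 0 ≤ F b) (hd : ∀ a, q₁ a → ¬ q₂ a) :
    ∑ b : {x // q₁ x}, F b + ∑ b : {x // q₂ x}, F b ≤ ∑ b, F b := by
  rw [sum_subtype_eq_sum_ite q₁ F, sum_subtype_eq_sum_ite q₂ F, ← Finset.sum_add_distrib]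
  refine Finset.sum_le_sum fun b _ => ?_
  by_cases h1 : q₁ b
  · rw [if_pos h1, if_neg (hd b h1), add_zero]
  · rw [if_neg h1, zero_add]; split_ifs <;> simp [hF b]

/-- `rsel` acts as «extend by zero, restrict»: `(rsel p q · w)(a) = (ext w)(a)`. [folklore] -/
theorem rsel_mulVec (w : {a // p a} → ℂ) : rsel p q *ᵥ w = fun a : {a // q a} => ext p w a := by
  rw [rsel, toBlock_mulVec']
  funext a
  rw [Matrix.one_mulVec]

/-- `((rsel p q)ᴴ · u)(a) = (ext u)(a)`. [folklore] -/
theorem conjTranspose_rsel_mulVec (u : {a // q a} → ℂ) : (rsel p q)ᴴ *ᵥ u = fun a : {a // p a} => ext q u a := by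
  rw [rsel_conjTranspose, rsel_mulVec]

/-- `nsq (rsel p q₁ · v) + nsq (rsel p q₂ · v) ≤ nsq v` for disjoint `q₁, q₂`. [folklore] -/
theorem nsq_rsel_add_nsq_rsel_le (hd : ∀ a, q₁ a → ¬ q₂ a) (v : {a // p a} → ℂ) :
    nsq (rsel p q₁ *ᵥ v) + nsq (rsel p q₂ *ᵥ v) ≤ nsq v := by
  rw [rsel_mulVec, rsel_mulVec, ← nsq_ext p v]
  exact sum_subtype_add_sum_subtype_le q₁ q₂ (F := fun b => ‖ext p v b‖ ^ 2) (fun b => by positivity) hd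

/-- **THE NORM LAW**: for DISJOINT `q₁′, q₂′` (rows) and DISJOINT `q₁, q₂` (columns), a decoupled assembly is bounded by the larger
block: `‖(rsel p′ q₁′)ᴴ·Y₁·rsel p q₁ + (rsel p′ q₂′)ᴴ·Y₂·rsel p q₂‖ ≤ c` whenever `‖Y₁‖, ‖Y₂‖ ≤ c`. [folklore] -/
theorem opNorm_blockDiag_le (hd : ∀ a, q₁ a → ¬ q₂ a) (hd' : ∀ b, q₁' b → ¬ q₂' b)
    {Y₁ : Matrix {b // q₁' b} {a // q₁ a} ℂ} {Y₂ : Matrix {b // q₂' b} {a // q₂ a} ℂ} {c : ℝ} (hc : 0 ≤ c)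
    (h₁ : ‖Y₁‖ ≤ c) (h₂ : ‖Y₂‖ ≤ c) :
    ‖(rsel p' q₁')ᴴ * Y₁ * rsel p q₁ + (rsel p' q₂')ᴴ * Y₂ * rsel p q₂‖ ≤ c := by
  refine opNorm_le_of_nsq_le_rect _ hc fun v => ?_
  set u₁ := Y₁ *ᵥ (rsel p q₁ *ᵥ v) with hu₁
  set u₂ := Y₂ *ᵥ (rsel p q₂ *ᵥ v) with hu₂
  have hZ : ((rsel p' q₁')ᴴ * Y₁ * rsel p q₁ + (rsel p' q₂')ᴴ * Y₂ * rsel p q₂) *ᵥ v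
      = fun b : {b // p' b} => ext q₁' u₁ b + ext q₂' u₂ b := by
    rw [Matrix.add_mulVec, ← Matrix.mulVec_mulVec, ← Matrix.mulVec_mulVec, ← Matrix.mulVec_mulVec, ← Matrix.mulVec_mulVec,
      ← hu₁, ← hu₂, conjTranspose_rsel_mulVec, conjTranspose_rsel_mulVec]
    rfl
  -- pointwise the two extensions have disjoint supports
  have hpt : ∀ b : {b // p' b}, ‖ext q₁' u₁ b + ext q₂' u₂ b‖ ^ 2 = ‖ext q₁' u₁ b‖ ^ 2 + ‖ext q₂' u₂ b‖ ^ 2 := by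
    intro b
    by_cases h1 : q₁' b
    · rw [ext_apply_of_not q₂' u₂ (hd' b h1), add_zero, norm_zero, zero_pow two_ne_zero, add_zero]
    · rw [ext_apply_of_not q₁' u₁ h1, zero_add, norm_zero, zero_pow two_ne_zero, zero_add]
  have hn : nsq (((rsel p' q₁')ᴴ * Y₁ * rsel p q₁ + (rsel p' q₂')ᴴ * Y₂ * rsel p q₂) *ᵥ v) ≤ nsq u₁ + nsq u₂ := by
    rw [hZ]
    unfold nsq
    simp_rw [hpt]
    rw [Finset.sum_add_distrib]
    refine add_le_add ?_ ?_
    · have := sum_subtype_le_sum p' (F := fun b => ‖ext q₁' u₁ b‖ ^ 2) (fun b => by positivity)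
      refine this.trans (le_of_eq ?_)
      have e := nsq_ext q₁' u₁
      unfold nsq at e; exact e
    · have := sum_subtype_le_sum p' (F := fun b => ‖ext q₂' u₂ b‖ ^ 2) (fun b => by positivity)
      refine this.trans (le_of_eq ?_)
      have e := nsq_ext q₂' u₂
      unfold nsq at e; exact e
  have hY₁ : nsq u₁ ≤ c ^ 2 * nsq (rsel p q₁ *ᵥ v) :=
    (nsq_mulVec_le_rect Y₁ _).trans (mul_le_mul_of_nonneg_right (pow_le_pow_left₀ (norm_nonneg _) h₁ 2) (nsq_nonneg _))
  have hY₂ : nsq u₂ ≤ c ^ 2 * nsq (rsel p q₂ *ᵥ v) :=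
    (nsq_mulVec_le_rect Y₂ _).trans (mul_le_mul_of_nonneg_right (pow_le_pow_left₀ (norm_nonneg _) h₂ 2) (nsq_nonneg _))
  have hv := nsq_rsel_add_nsq_rsel_le p q₁ q₂ hd v
  calc nsq (((rsel p' q₁')ᴴ * Y₁ * rsel p q₁ + (rsel p' q₂')ᴴ * Y₂ * rsel p q₂) *ᵥ v) ≤ nsq u₁ + nsq u₂ := hn
    _ ≤ c ^ 2 * nsq (rsel p q₁ *ᵥ v) + c ^ 2 * nsq (rsel p q₂ *ᵥ v) := add_le_add hY₁ hY₂
    _ = c ^ 2 * (nsq (rsel p q₁ *ᵥ v) + nsq (rsel p q₂ *ᵥ v)) := by ring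
    _ ≤ c ^ 2 * nsq v := mul_le_mul_of_nonneg_left hv (sq_nonneg c)

end Rsel

end Summit.QuantumFields.BalabanUV.T4Continuum.SubtypeDecoupling

end
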